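/-
COR-CM (cell pub-hodgecm2, stage 2 of the Hodge ladder) — Δ2 BRIDGE, ADAPTER TRACK (c-S.2) (coordinator 2026-08-23 21:40Z, user idea):
THE μ ↦ μᶜ RELABELLING LEMMAS AND DEF. 4.12 ADMISSIBILITY AT THE CONJUGATE NORMALISER.  Seat prover-pub-hodgecm2-d2bridge-adapt-3-g0-0
(ADAPTER seat 3 of 3: relabelling + admissibility; adapt-1 = statement∕assembly `AdapterMuConj.lean`, adapt-2 = contragredient Ω-transport).
NEW FILE, THEOREMS ONLY (kernel lane); explicit per-theorem binders, no `variable`, no instance, no named fact; nothing landed is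
edited or restated — every tree fact is IMPORTED.  HC_CM is NOT proved; «Δ2 BRIDGE CLOSED» is NOT claimed; hLiu = «[Liu21] Thm 4.18 at the
constructed objects AS A READING (r8)»; status HELD pending orientation re-key; no pointer moves.
-/
import Summits.HodgeConjecture.CorCM.D2Bridge.ReflexOfTypeConj
import Literature.NumberTheory.ComplexMultiplication.CMTypeBasic
import Summits.HodgeConjecture.CorCM.B01.Transposition.Item6OmegaTransportCenter
import Literature.NumberTheory.Automorphic.IdeleClassCharacterConjugate
import Literature.AlgebraicGeometry.Liu2021.AdmissibleElement
import HarnessLib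

set_option autoImplicit false

/-!
# Δ2 adapter (c-S.2): the `μ ↦ μᶜ` relabelling at the pin, and Def. 4.12 admissibility at the conjugate normaliser

THE PARAGRAPH (as the paper would print it).  «Let `ν := μᶜ = μ ∘ c` ([Liu21] §4.1, l. 1912).  By Remark 4.4, `ν` is conjugate
symplectic of weight one with `Φ_ν = Φ̄_μ`, `M_ν = M_μ`, `M'_ν = M'_μ`; hence `ι₁ ∈ Φ_μ ⟺ ῑ₁ ∈ Φ_ν`, and a CM record is
`(ι₁, Φ_μ)`-admissible iff it is `(ῑ₁, Φ_ν)`-admissible ([Shimura98] §8.3 Prop. 28: complex conjugation is central in `Gal(L/ℚ)`).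
By Definition 4.12 (last sentence) `ε` is `μ`-admissible iff `−ε` is `ν`-admissible: at the line of record `⟨a⟩` the element
`e₀ = a·(2δ_L)⁻¹` witnesses `μ`-admissibility and `−e₀ = a·δ″`, `δ″ := −(2δ_L)⁻¹ = \overline{(2δ_L)⁻¹}`, witnesses `ν`-admissibility.
We apply Theorem 4.18 to `ν` at the uniformising embedding `τ′ = ῑ₁ ∈ Φ_ν`.»

WHAT IS HERE (spelling: `μᶜ := IdeleClassGroup.galConj (IsCMField.complexConj F) μ`, `ῑ₁ := (starRingEnd ℂ).comp ι₁`):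
* §1 `mem_cmType_iff_conjugate_mem_cmType_galConj` ∕ `…_starRingEnd_comp_…` — **`ι₁ ∈ Φ_μ ↔ ῑ₁ ∈ Φ_{μᶜ}`** (the dictionary's
  `PhiMu` relabelled), from ✔ `IsConjugateSymplectic.cmType_galConj : Φ_{μᶜ} = Φ̄_μ`;
* §2 `isReflexOfTypeG_cmType_iff_starRingEnd_comp_galConj` — **`C.IsReflexOfTypeG ι₁ Φ_μ ↔ C.IsReflexOfTypeG ῑ₁ Φ_{μᶜ}`** (the
  dictionary's `adm` relabelled), from prove-3's ✔ `isReflexOfTypeG_conj_iff` (= own-crow's `isReflexOfTypeG_starRingEnd_comp_iff`) + `cmType_galConj` + `bar_bar`;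
* §3 **Def. 4.12 at the conjugate normaliser**: `isAdmissibleElement_bar_mul_neg` (if `Φ` is δ-positive at the real scalar `a` and `δ′` is
  anti-oriented to `δ_F`, then `a·(−δ′)` is admissible for `Φ̄`), its `μᶜ` form `isAdmissibleElement_cmType_galConj_mul_neg`, the token
  form at `δ″ := −(2δ_F)⁻¹` (`…_mul_conjNormaliser`), the identity `δ″ = \overline{(2δ_F)⁻¹}` (`neg_inv_two_mul_imagUnit_eq_complexConj`),
  and the SIGN CHECK `not_isAdmissibleElement_bar_mul` (at `+δ′` the element `a·δ′` is NOT `Φ̄`-admissible: the CONJ orientation is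
  uninhabited at the normaliser of record — prove-6's T-SIGN read for `μᶜ`);
* §3b NON-VACUITY, label form: `epsOf_neg_normaliser` (`epsOf_{−δ′}(e) = epsOf_{δ′}(−e)`: adapter seat 1's relabelled family
  `muConj.epsOf e := epsOf (−e)` IS the `δ″` reading), `exists_isAdmissibleElement_cmType_galConj_epsOf_neg[_deltaPrime]` (THE EXHIBIT: a
  `μᶜ`-admissible `e` with `epsOf_{δ′}(−e) = locF a`, the package's own label of the line `⟨a⟩`), `not_isAdmissibleElement_cmType_galConj_mul_deltaPrime`.
  WHICH BLOCK (orientation memo's caution): these lemmas certify the INDEX; which `𝔾(𝔸^∞)`-module the relabelled family carries at that index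
  (the line's own Weil block, read as Liu's `ω(μᶜ, −ε, χ⁻¹) = ω(μ, ε, χ)^∨` by [Liu21, Lem. D.1 (2)]) is the adapter's LABEL claim, judged by
  the referees (world W-A of the assembler's DECISION #15 input), not asserted here.

NOT HERE: the contragredient Ω-transport (adapt-2), the statement∕assembly (adapt-1), any edit of `liuDictionaryPin` ∕ `PinSignatures`.
`η_{μᶜ} = c ∘ η_μ` (Def. 4.5 (1)) and the CM-datum transport `D ↦ D^{(c)}` are deferred to a sequel if the assembly consumes them
(the adapter instantiates `hLiu` at `ν` itself, whose `𝒜(ν)` objects are CM data for `ν` by construction).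

References: [Liu2021] Y. Liu, *Fourier–Jacobi cycles and arithmetic relative trace formula*, Camb. J. Math. 9 (2021) = arXiv:2102.11518,
§4.1 (l. 1912), Remark 4.4 (ll. 1930–1933), Def. 4.12 (ll. 2102–2109), Thm. 4.18 (ll. 2232–2237); [Shimura1998] G. Shimura, *Abelian
Varieties with Complex Multiplication and Modular Functions*, §8.3 Prop. 28.
-/

noncomputable section

namespace Summit.HodgeConjecture.CorCM.D2Bridge.AdapterRelabel

open NumberField NumberField.ComplexEmbedding
open Literature.AlgebraicGeometry.Motives (CMType)
open Literature.AlgebraicGeometry.Liu2021 (IsAdmissibleElement isAdmissibleElement_conj_neg_iff)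
open Literature.NumberTheory.ComplexMultiplication
open Literature.NumberTheory.ComplexMultiplication.CMTypeOps (bar mem_bar_iff bar_bar mem_bar_iff_conjugate_mem
  coe_bar_eq_setOf_conjugate_mem conjugate_mem_iff_notMem)
open Literature.NumberTheory.Automorphic Literature.NumberTheory.Automorphic.IdeleClassGroup
open Literature.NumberTheory.GelbartRogawski1991.UnitaryDualPair
open Literature.NumberTheory.Automorphic.Liu2021.Def411WeilCarriers (epsOf locF epsOf_algebraMap_mul)
open Summit.HodgeConjecture.CorCM.Transposition.OmegaTransport
open HodgeCM.Model (LiuCMSide)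

/-! ## §1 `PhiMu` relabelled: `ι₁ ∈ Φ_μ ↔ ῑ₁ ∈ Φ_{μᶜ}` -/

section PhiMu

variable {E : Type} [Field E] [NumberField E] [IsCMField E]

/-- **`τ ∈ Φ_μ ↔ τ̄ ∈ Φ_{μᶜ}`** ([Liu21] Rem. 4.4 «`Φ_{μᶜ} = Φ̄_μ`», tree `IsConjugateSymplectic.cmType_galConj`): membership of an
embedding in the CM type of `μ` is membership of its conjugate in the CM type of `μᶜ = μ ∘ c`. [cite: Liu2021, Remark 4.4 (TeX ll. 1930–1933)] -/
theorem mem_cmType_iff_conjugate_mem_cmType_galConj {μ : Literature.NumberTheory.Automorphic.IdeleClassGroup E →ₜ* Circle} (hμ : IsConjugateSymplectic E μ)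
    (τ : E →+* ℂ) : τ ∈ hμ.cmType.1 ↔ conjugate τ ∈ hμ.galConj.cmType.1 := by
  rw [hμ.cmType_galConj, mem_bar_iff_conjugate_mem, involutive_conjugate E τ]

/-- The `starRingEnd` spelling of the pin files (`ῑ₁ := (starRingEnd ℂ).comp ι₁`): **`ι₁ ∈ Φ_μ ↔ ῑ₁ ∈ Φ_{μᶜ}`** — the dictionary's
`PhiMu i = (ι₁ ∈ Φ_{μ_i})` IS Liu's side condition «`τ′ ∈ Φ_ν`» at `(ν, τ′) = (μ_iᶜ, ῑ₁)`. [cite: Liu2021, Remark 4.4 (TeX ll. 1930–1933)] -/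
theorem mem_cmType_iff_starRingEnd_comp_mem_cmType_galConj {μ : Literature.NumberTheory.Automorphic.IdeleClassGroup E →ₜ* Circle}
    (hμ : IsConjugateSymplectic E μ) (ι₁ : E →+* ℂ) :
    ι₁ ∈ hμ.cmType.1 ↔ (starRingEnd ℂ).comp ι₁ ∈ hμ.galConj.cmType.1 :=
  mem_cmType_iff_conjugate_mem_cmType_galConj hμ ι₁

/-- Converse reading: **`ῑ₁ ∈ Φ_μ ↔ ι₁ ∈ Φ_{μᶜ}`**. [cite: Liu2021, Remark 4.4 (TeX ll. 1930–1933)] -/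
theorem starRingEnd_comp_mem_cmType_iff_mem_cmType_galConj {μ : Literature.NumberTheory.Automorphic.IdeleClassGroup E →ₜ* Circle}
    (hμ : IsConjugateSymplectic E μ) (ι₁ : E →+* ℂ) :
    (starRingEnd ℂ).comp ι₁ ∈ hμ.cmType.1 ↔ ι₁ ∈ hμ.galConj.cmType.1 := by
  rw [hμ.cmType_galConj, mem_bar_iff_conjugate_mem]
  exact Iff.rfl

/-- `μᶜ` is again conjugate symplectic of weight one ([Liu21] Rem. 4.4, first sentence; tree `IsConjugateSymplectic.galConj`,
`HasWeight.galConj_complexConj`) — re-exported in the adapter's spelling for the `(hμ, hw)` slots of the Liu rest.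
[cite: Liu2021, Remark 4.4 (TeX ll. 1930–1933)] -/
theorem isConjugateSymplectic_and_hasWeight_galConj {μ : Literature.NumberTheory.Automorphic.IdeleClassGroup E →ₜ* Circle} (hμ : IsConjugateSymplectic E μ)
    (hw : HasWeight E μ 1) :
    IsConjugateSymplectic E (galConj (IsCMField.complexConj E) μ) ∧ HasWeight E (galConj (IsCMField.complexConj E) μ) 1 :=
  ⟨hμ.galConj, hw.galConj_complexConj⟩

end PhiMu

/-! ## §2 `adm` relabelled: `(ι₁, Φ_μ)`-admissibility is `(ῑ₁, Φ_{μᶜ})`-admissibility -/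

section Adm

variable {L : HodgeCM.CMField}

/-- The package's conjugate type of the Literature's conjugate type is the type (both are the complement). [folklore] -/
theorem hodgeCM_bar_bar (Φ : CMType L) : HodgeCM.CMTypeOps.bar (bar Φ) = Φ :=
  Subtype.ext (compl_compl Φ.1)

/-- The two spellings of the conjugate type agree (package `HodgeCM.CMTypeOps.bar` = Literature `CMTypeOps.bar`, definitionally). [folklore] -/
theorem hodgeCM_bar_eq_bar (Φ : CMType L) : HodgeCM.CMTypeOps.bar Φ = bar Φ := rfl

/-- **`C.IsReflexOfTypeG ι₁ Φ_μ ↔ C.IsReflexOfTypeG ῑ₁ Φ_{μᶜ}`** — the (J3) dictionary's admissibility predicate `adm i d :=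
d.IsReflexOfTypeG ι₁ Φ_{μ_i}` IS `(ῑ₁, Φ_ν)`-admissibility for `ν = μ_iᶜ` ([Liu21] Def. 4.3 read through the conjugate pin: prove-3's
`isReflexOfTypeG_conj_iff` «through `ῑ₁` = for the conjugate type», and `Φ_{μᶜ} = Φ̄_μ`).
[cite: Liu2021, Definition 4.3 (TeX ll. 1914–1921) and Remark 4.4 (ll. 1930–1933)] [cite: Shimura1998, §8.3 Prop. 28] -/
theorem isReflexOfTypeG_cmType_iff_starRingEnd_comp_galConj (ι₁ : (L : Type) →+* ℂ) (C : LiuCMSide)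
    {μ : Literature.NumberTheory.Automorphic.IdeleClassGroup L →ₜ* Circle} (hμ : IsConjugateSymplectic L μ) :
    C.IsReflexOfTypeG ι₁ hμ.cmType ↔ C.IsReflexOfTypeG ((starRingEnd ℂ).comp ι₁) hμ.galConj.cmType := by
  rw [hμ.cmType_galConj, isReflexOfTypeG_conj_iff, hodgeCM_bar_bar]

/-- The unguarded form: `C.IsReflexOfType ι₁ Φ_μ ↔ C.IsReflexOfType ῑ₁ Φ_{μᶜ}`.
[cite: Liu2021, Remark 4.4 (TeX ll. 1930–1933)] [cite: Shimura1998, §8.3 Prop. 28] -/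
theorem isReflexOfType_cmType_iff_starRingEnd_comp_galConj (ι₁ : (L : Type) →+* ℂ) (C : LiuCMSide)
    {μ : Literature.NumberTheory.Automorphic.IdeleClassGroup L →ₜ* Circle} (hμ : IsConjugateSymplectic L μ) :
    C.IsReflexOfType ι₁ hμ.cmType ↔ C.IsReflexOfType ((starRingEnd ℂ).comp ι₁) hμ.galConj.cmType := by
  rw [hμ.cmType_galConj, isReflexOfType_conj_iff, hodgeCM_bar_bar]

/-- Read the other way (records presented at `ῑ₁` for `μ` are the `(ι₁, Φ_{μᶜ})`-admissible ones):
`C.IsReflexOfTypeG ῑ₁ Φ_μ ↔ C.IsReflexOfTypeG ι₁ Φ_{μᶜ}`. [cite: Liu2021, Remark 4.4 (TeX ll. 1930–1933)] -/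
theorem isReflexOfTypeG_starRingEnd_comp_cmType_iff_galConj (ι₁ : (L : Type) →+* ℂ) (C : LiuCMSide)
    {μ : Literature.NumberTheory.Automorphic.IdeleClassGroup L →ₜ* Circle} (hμ : IsConjugateSymplectic L μ) :
    C.IsReflexOfTypeG ((starRingEnd ℂ).comp ι₁) hμ.cmType ↔ C.IsReflexOfTypeG ι₁ hμ.galConj.cmType := by
  rw [isReflexOfTypeG_conj_iff, hμ.cmType_galConj, hodgeCM_bar_eq_bar]

end Adm

/-! ## §3 Def. 4.12 at the conjugate normaliser `δ″ = −δ′ = δ̄′` -/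

section ConjNormaliser

/-- **[Liu21, Def. 4.12] for the conjugate type at the NEGATED normaliser.**  If `Φ` is δ-positive at the real scalar `a`
(`0 < Im τ(δ_F·a)` on `Φ`, the line of record's `Φ^δ(a)`) and `δ′ ∈ F^{×−}` is anti-oriented to `δ_F`, then `a·(−δ′)` is admissible
for `Φ̄`: it is `−e₀` for the `Φ`-admissible `e₀ = a·δ′` (`isAdmissibleElement_mul_of_antiOriented`), and «`ε` is `μ`-admissible iff `−ε`
is `μᶜ`-admissible» (`isAdmissibleElement_conj_neg_iff`, `Φ_{μᶜ} = Φ̄_μ`). [cite: Liu2021, Def. 4.12 (TeX ll. 2102–2109)] -/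
theorem isAdmissibleElement_bar_mul_neg (F : CMField) (Φ : CMType F) (a : (↥(maximalRealSubfield F))ˣ) (δ' : F)
    (hcδ' : IsCMField.complexConj F δ' = -δ') (hδ'0 : δ' ≠ 0)
    (hδ' : ∀ τ : F →+* ℂ, (τ δ').im * (τ (imagUnit F)).im < 0)
    (hΦ : ∀ τ : F →+* ℂ, τ ∈ Φ.1 → 0 < (τ (imagUnit F * algebraMap ↥(maximalRealSubfield F) F a)).im) :
    IsAdmissibleElement F (bar Φ).1 (algebraMap ↥(maximalRealSubfield F) F a * -δ') := by
  rw [mul_neg, coe_bar_eq_setOf_conjugate_mem, isAdmissibleElement_conj_neg_iff]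
  exact isAdmissibleElement_mul_of_antiOriented F Φ a δ' hcδ' hδ'0 hδ' hΦ

/-- **The `μᶜ` form**: for `μ` conjugate symplectic with `Φ_μ` δ-positive at `a` and `δ′` anti-oriented, `a·(−δ′)` is `μᶜ`-admissible
(`IsAdmissibleElement F Φ_{μᶜ} (a·(−δ′))`). [cite: Liu2021, Def. 4.12 (TeX ll. 2102–2109) and Remark 4.4] -/
theorem isAdmissibleElement_cmType_galConj_mul_neg (F : CMField) {μ : Literature.NumberTheory.Automorphic.IdeleClassGroup F →ₜ* Circle}
    (hμ : IsConjugateSymplectic F μ) (a : (↥(maximalRealSubfield F))ˣ) (δ' : F)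
    (hcδ' : IsCMField.complexConj F δ' = -δ') (hδ'0 : δ' ≠ 0)
    (hδ' : ∀ τ : F →+* ℂ, (τ δ').im * (τ (imagUnit F)).im < 0)
    (hΦ : ∀ τ : F →+* ℂ, τ ∈ hμ.cmType.1 → 0 < (τ (imagUnit F * algebraMap ↥(maximalRealSubfield F) F a)).im) :
    IsAdmissibleElement F hμ.galConj.cmType.1 (algebraMap ↥(maximalRealSubfield F) F a * -δ') := by
  rw [hμ.cmType_galConj]
  exact isAdmissibleElement_bar_mul_neg F hμ.cmType a δ' hcδ' hδ'0 hδ' hΦ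

/-- **THE CONJUGATE NORMALISER IS THE NEGATED ONE**: `−(2δ_F)⁻¹ = \overline{(2δ_F)⁻¹}` (`δ_F` is purely imaginary). [folklore] -/
theorem neg_inv_two_mul_imagUnit_eq_complexConj (F : CMField) :
    -(2 * imagUnit F)⁻¹ = IsCMField.complexConj F (2 * imagUnit F)⁻¹ := by
  rw [complexConj_inv_two_mul_imagUnit]

/-- `δ″ = −(2δ_F)⁻¹` is purely imaginary: `δ̄″ = −δ″`. [folklore] -/
theorem complexConj_neg_inv_two_mul_imagUnit (F : CMField) :
    IsCMField.complexConj F (-(2 * imagUnit F)⁻¹) = -(-(2 * imagUnit F)⁻¹) := by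
  rw [map_neg, complexConj_inv_two_mul_imagUnit]

/-- `δ″ = −(2δ_F)⁻¹ ≠ 0`. [folklore] -/
theorem neg_inv_two_mul_imagUnit_ne_zero (F : CMField) : -(2 * imagUnit F)⁻¹ ≠ 0 :=
  neg_ne_zero.2 (inv_two_mul_imagUnit_ne_zero F)

/-- `δ″ = −(2δ_F)⁻¹` is CO-oriented with `δ_F` (`0 < Im τ(δ″)·Im τ(δ_F)` at every `τ`) — the opposite orientation to the normaliser
of record `(2δ_F)⁻¹` (`antiOriented_inv_two_mul_imagUnit`). [folklore] -/
theorem coOriented_neg_inv_two_mul_imagUnit (F : CMField) (τ : F →+* ℂ) :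
    0 < (τ (-(2 * imagUnit F)⁻¹)).im * (τ (imagUnit F)).im := by
  rw [map_neg, Complex.neg_im, neg_mul]
  exact neg_pos.2 (antiOriented_inv_two_mul_imagUnit F τ)

/-- **Def. 4.12's witness for `μᶜ` at the token of record**: with `Φ_μ` δ-positive at `a` (the line `⟨a⟩` carries the `μ`-admissible
`e₀ = a·(2δ_F)⁻¹`, F4's `admIndexAtDeltaPrime`), the element `a·δ″ = −e₀`, `δ″ := −(2δ_F)⁻¹`, is `μᶜ`-admissible.
[cite: Liu2021, Def. 4.12 (TeX ll. 2102–2109) and Remark 4.4] -/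
theorem isAdmissibleElement_cmType_galConj_mul_conjNormaliser (F : CMField) {μ : Literature.NumberTheory.Automorphic.IdeleClassGroup F →ₜ* Circle}
    (hμ : IsConjugateSymplectic F μ) (a : (↥(maximalRealSubfield F))ˣ)
    (hΦ : ∀ τ : F →+* ℂ, τ ∈ hμ.cmType.1 → 0 < (τ (imagUnit F * algebraMap ↥(maximalRealSubfield F) F a)).im) :
    IsAdmissibleElement F hμ.galConj.cmType.1 (algebraMap ↥(maximalRealSubfield F) F a * -(2 * imagUnit F)⁻¹) :=
  isAdmissibleElement_cmType_galConj_mul_neg F hμ a (2 * imagUnit F)⁻¹ (complexConj_inv_two_mul_imagUnit F)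
    (inv_two_mul_imagUnit_ne_zero F) (antiOriented_inv_two_mul_imagUnit F) hΦ

/-- Every CM type's conjugate is inhabited (a number field has a complex embedding; exactly one of `σ`, `σ̄` lies in `Φ`). [folklore] -/
theorem nonempty_bar (F : CMField) (Φ : CMType F) : (bar Φ).1.Nonempty := by
  obtain ⟨σ⟩ : Nonempty (F →+* ℂ) := inferInstance
  by_cases hσ : σ ∈ Φ.1
  · exact ⟨conjugate σ, (mem_bar_iff_conjugate_mem Φ _).2 (by rwa [involutive_conjugate F σ])⟩
  · exact ⟨σ, (mem_bar_iff Φ σ).2 hσ⟩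

/-- **SIGN CHECK — at the normaliser of record the conjugate type is uninhabited on the line `⟨a⟩`.**  If `Φ` is δ-positive at `a` and
`δ′` is anti-oriented to `δ_F`, then `a·δ′` is NOT admissible for `Φ̄` (on `Φ̄` the sign of `Im τ(δ_F a)` is reversed, so `Im τ(a δ′) > 0`
there): the index of [Liu21, Thm 4.18] for `μᶜ` at the package's line needs the flipped normaliser `−δ′` of
`isAdmissibleElement_bar_mul_neg`.  (prove-6's T-SIGN «CONJ uninhabited at `(2δ_L)⁻¹`», read for `μᶜ`.) [cite: Liu2021, Def. 4.12 (TeX ll. 2102–2109)] -/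
theorem not_isAdmissibleElement_bar_mul (F : CMField) (Φ : CMType F) (a : (↥(maximalRealSubfield F))ˣ) (δ' : F)
    (hδ' : ∀ τ : F →+* ℂ, (τ δ').im * (τ (imagUnit F)).im < 0)
    (hΦ : ∀ τ : F →+* ℂ, τ ∈ Φ.1 → 0 < (τ (imagUnit F * algebraMap ↥(maximalRealSubfield F) F a)).im) :
    ¬ IsAdmissibleElement F (bar Φ).1 (algebraMap ↥(maximalRealSubfield F) F a * δ') := by
  intro hadm
  obtain ⟨τ, hτ⟩ := nonempty_bar F Φ
  -- `τ(a)` is real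
  have hre : (τ (algebraMap ↥(maximalRealSubfield F) F a)).im = 0 := by
    have hmem := (a : ↥(maximalRealSubfield F)).2
    rw [NumberField.mem_maximalRealSubfield_iff] at hmem
    exact Complex.conj_eq_iff_im.1 (hmem τ)
  -- on `Φ̄`, `Im τ(δ_F a) < 0`: its conjugate lies in `Φ`
  have h1 : 0 < ((conjugate τ) (imagUnit F * algebraMap ↥(maximalRealSubfield F) F a)).im :=
    hΦ (conjugate τ) ((mem_bar_iff_conjugate_mem Φ τ).1 hτ)
  rw [conjugate_coe_eq, Complex.conj_im] at h1
  have h2 := hadm.2.2 τ hτ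
  have h3 := hδ' τ
  simp only [map_mul, Complex.mul_im, hre, mul_zero, zero_mul, zero_add, add_zero] at h1 h2
  nlinarith [sq_nonneg ((τ (imagUnit F)).im), sq_nonneg ((τ (algebraMap ↥(maximalRealSubfield F) F a)).re), h1, h2, h3,
    mul_self_pos.2 (im_embedding_imagUnit_ne_zero F τ)]

/-- The `μᶜ` form of the sign check: `a·δ′` is not `μᶜ`-admissible (at an anti-oriented `δ′`, `Φ_μ` δ-positive at `a`).
[cite: Liu2021, Def. 4.12 (TeX ll. 2102–2109) and Remark 4.4] -/
theorem not_isAdmissibleElement_cmType_galConj_mul (F : CMField) {μ : Literature.NumberTheory.Automorphic.IdeleClassGroup F →ₜ* Circle}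
    (hμ : IsConjugateSymplectic F μ) (a : (↥(maximalRealSubfield F))ˣ) (δ' : F)
    (hδ' : ∀ τ : F →+* ℂ, (τ δ').im * (τ (imagUnit F)).im < 0)
    (hΦ : ∀ τ : F →+* ℂ, τ ∈ hμ.cmType.1 → 0 < (τ (imagUnit F * algebraMap ↥(maximalRealSubfield F) F a)).im) :
    ¬ IsAdmissibleElement F hμ.galConj.cmType.1 (algebraMap ↥(maximalRealSubfield F) F a * δ') := by
  rw [hμ.cmType_galConj]
  exact not_isAdmissibleElement_bar_mul F hμ.cmType a δ' hδ' hΦ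


/-! ### §3b The relabelled index set is inhabited at the line of record (non-vacuity, label form) -/

/-- **Reading a collection through the conjugate normaliser is reading the negated element through the normaliser of record**:
`epsOf_{−δ′}(e) = epsOf_{δ′}(−e)` (both are the local classes of `−e/δ′`).  This is the label half of «`ε` is `μ`-admissible iff `−ε` is
`μᶜ`-admissible»: adapter seat 1's relabelled family `muConj.epsOf e := epsOf_{δ′}(−e)` IS the `δ″ = −δ′` reading. [cite: Liu2021, Def. 4.12 (TeX ll. 2105–2109)] -/
theorem epsOf_neg_normaliser (F : CMField) (δ' e : F) :
    epsOf ↥(maximalRealSubfield F) (imagUnitSq F) F (-δ') e = epsOf ↥(maximalRealSubfield F) (imagUnitSq F) F δ' (-e) := by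
  have key : e * (-δ')⁻¹ = -e * δ'⁻¹ := by rw [inv_neg, mul_neg, neg_mul]
  unfold Literature.NumberTheory.Automorphic.Liu2021.Def411WeilCarriers.epsOf
  rw [key]

/-- **NON-VACUITY OF THE `μᶜ`-INDEX SET AT THE LINE OF RECORD (label form, δ′-generic).**  With `Φ_μ` δ-positive at `a` and `δ′` anti-oriented:
there is a `μᶜ`-admissible `e` (namely `e = a·(−δ′) = −e₀`) whose NEGATIVE generates, through `δ′`, the package's own label `locF a` of the line
`⟨a⟩` — i.e. the pair `(locF a, χ)` is an index of [Liu21, Thm 4.18]'s direct sum for the family relabelled by `epsOf ↦ (e ↦ epsOf (−e))` at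
`ν = μᶜ` (adapter seat 1's `muConj`), equivalently for Def. 4.12 read through `δ″ = −δ′` (`epsOf_neg_normaliser`).
[cite: Liu2021, Def. 4.12 (TeX ll. 2102–2109), Thm. 4.18 (ll. 2232–2237)] -/
theorem exists_isAdmissibleElement_cmType_galConj_epsOf_neg (F : CMField)
    {μ : Literature.NumberTheory.Automorphic.IdeleClassGroup F →ₜ* Circle} (hμ : IsConjugateSymplectic F μ)
    (a : (↥(maximalRealSubfield F))ˣ) (δ' : F) (hcδ' : IsCMField.complexConj F δ' = -δ') (hδ'0 : δ' ≠ 0)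
    (hδ' : ∀ τ : F →+* ℂ, (τ δ').im * (τ (imagUnit F)).im < 0)
    (hΦ : ∀ τ : F →+* ℂ, τ ∈ hμ.cmType.1 → 0 < (τ (imagUnit F * algebraMap ↥(maximalRealSubfield F) F a)).im) :
    ∃ e : F, IsAdmissibleElement F hμ.galConj.cmType.1 e ∧
      epsOf ↥(maximalRealSubfield F) (imagUnitSq F) F δ' (-e) = locF ↥(maximalRealSubfield F) (imagUnitSq F) a :=
  ⟨algebraMap ↥(maximalRealSubfield F) F a * -δ', isAdmissibleElement_cmType_galConj_mul_neg F hμ a δ' hcδ' hδ'0 hδ' hΦ, by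
    rw [mul_neg, neg_neg]
    exact epsOf_algebraMap_mul ↥(maximalRealSubfield F) (imagUnitSq F) F δ' hδ'0 a⟩

/-- **The same at the token of record `δ′ = (2δ_F)⁻¹`** (F4 `OmegaAtDeltaPrime`'s normaliser; element `a·δ″`, `δ″ = −(2δ_F)⁻¹`): THE EXHIBIT for
the referee's non-vacuity check of the adapter's index set at the line `⟨a⟩`. [cite: Liu2021, Def. 4.12 (TeX ll. 2102–2109), Thm. 4.18 (ll. 2232–2237)] -/
theorem exists_isAdmissibleElement_cmType_galConj_epsOf_neg_deltaPrime (F : CMField)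
    {μ : Literature.NumberTheory.Automorphic.IdeleClassGroup F →ₜ* Circle} (hμ : IsConjugateSymplectic F μ)
    (a : (↥(maximalRealSubfield F))ˣ)
    (hΦ : ∀ τ : F →+* ℂ, τ ∈ hμ.cmType.1 → 0 < (τ (imagUnit F * algebraMap ↥(maximalRealSubfield F) F a)).im) :
    ∃ e : F, IsAdmissibleElement F hμ.galConj.cmType.1 e ∧
      epsOf ↥(maximalRealSubfield F) (imagUnitSq F) F (2 * imagUnit F)⁻¹ (-e) = locF ↥(maximalRealSubfield F) (imagUnitSq F) a :=
  exists_isAdmissibleElement_cmType_galConj_epsOf_neg F hμ a (2 * imagUnit F)⁻¹ (complexConj_inv_two_mul_imagUnit F)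
    (inv_two_mul_imagUnit_ne_zero F) (antiOriented_inv_two_mul_imagUnit F) hΦ

/-- **SIGN CHECK at the token of record**: the representative `e₀ = a·(2δ_F)⁻¹` itself (the `μ`-admissible element of F4's `admIndexAtDeltaPrime`)
is NOT `μᶜ`-admissible — the negation in `exists_isAdmissibleElement_cmType_galConj_epsOf_neg_deltaPrime` is forced (prove-6's T-SIGN «CONJ
uninhabited at `(2δ_L)⁻¹`», read for `μᶜ`). [cite: Liu2021, Def. 4.12 (TeX ll. 2102–2109)] -/
theorem not_isAdmissibleElement_cmType_galConj_mul_deltaPrime (F : CMField)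
    {μ : Literature.NumberTheory.Automorphic.IdeleClassGroup F →ₜ* Circle} (hμ : IsConjugateSymplectic F μ)
    (a : (↥(maximalRealSubfield F))ˣ)
    (hΦ : ∀ τ : F →+* ℂ, τ ∈ hμ.cmType.1 → 0 < (τ (imagUnit F * algebraMap ↥(maximalRealSubfield F) F a)).im) :
    ¬ IsAdmissibleElement F hμ.galConj.cmType.1 (algebraMap ↥(maximalRealSubfield F) F a * (2 * imagUnit F)⁻¹) :=
  not_isAdmissibleElement_cmType_galConj_mul F hμ a (2 * imagUnit F)⁻¹ (antiOriented_inv_two_mul_imagUnit F) hΦ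

end ConjNormaliser


end Summit.HodgeConjecture.CorCM.D2Bridge.AdapterRelabel

end
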